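import Summits.ResolutionOfSingularities.ResolutionOfSingularities.Theorems.EquisingularLiftEquisingularLiftNatResidueHypDefsE11
import Literature.AlgebraicGeometry.Resolution.Blowups
import HarnessLib

/-!
# EL♮(3) / EL♮(n), RUNG LC «large characteristic» — brick (B5) bookkeeping: the GENERIC-POINT THREAD of the K-side word (the running transform
# dominates `Y₀`; with the position token, the centre never swallows the transform; hence the strict transforms of the integral hypersurface stay integral)

leafhand-res-equisingularlift-3 g0 (prover, 2026-08-31; one-generation line-first hand on stmt-ResolutionOfSingularities-20148 / -20038 /
-15660, cell `pub/decomp-res`).  Crux `EquisingularLiftNatThree` (`stmt-…-20148`; uniform in `n`, so also `stmt-…-20038`), line W4.5(b), RUNG LC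
(idea-2 g32 `Cruxes/EquisingularLiftNatThree/LARGE-CHAR-RUNG-idea2.md` v1.6 §(B5′)).  The (B5) recursion reads the K-side word ✓ `DescTransformOK`
(…NatResidueHypDefsE10 :60) of ✓ `LargeChar.exists_centreSeq_descTransformOK` stage by stage and needs, at each stage, that the K-side strict transform
`V(𝓣ᵢ,K)` is INTEGRAL (to feed (a) END: integral ⇒ reduced, so the regular reduced structure of the END token is `V(𝓣_r,K)` itself, smooth in
characteristic 0, and (b) irreducibility of the running set).  Integrality propagates by ✓ `…Sections.isIntegral_subscheme_strictTransformIdeal`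
(…NatNoseSectionStepTools, Stacks 080E/02ND) PROVIDED the centre does not swallow the transform, `¬ supp 𝓣_K ⊆ supp C_K` — which the K-side
position token `σ '' supp C ⊆ {x | ¬ IsGenericPoint x Y₀}` gives once one knows that the running transform DOMINATES `Y₀`: its generic points map to
generic points of `Y₀` (GEN).  This file proves the thread, DEF-FREE:

* `gen_of_eq` — GEN at the foot (`σ = 𝟙`, `Y = Y₀`);
* `not_subset_support_of_gen` — **GEN + position token + `Y` irreducible closed ⇒ the centre does not swallow `Y`** (the generic point of `Y`,
  Mathlib `IsIrreducible.genericPoint`, would lie in `supp C` and map to a generic point of `Y₀`);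
* ★ `gen_closure_preimage_diff_of_isBlowup` — **GEN survives a blow-up step**: for `π : X' → X` a blow-up along `C`, `Y` irreducible closed with
  `¬ Y ⊆ supp C` and GEN for `(σ, Y₀)`, every generic point `y'` of the strict transform `Y' = closure (π⁻¹ (Y ∖ supp C))` maps under `π ≫ σ` to a
  generic point of `Y₀`: `π y'` is generic in `closure (π '' Y') = Y` (Mathlib `IsGenericPoint.image`; `π '' Y' ⊆ Y`; `Y ∖ supp C ⊆ π '' Y'` because
  `π` is surjective over `X ∖ supp C` — ✓ `IsBlowup.isIso_compl` — and `Y ∖ supp C` is dense in the irreducible `Y`,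
  Mathlib `subset_closure_inter_of_isPreirreducible_of_isOpen`).

Companion of ✓ `…NatLargeCharPositionToken` (the converse invariant INV: points over generic points are generic).  EL♮(3) NOT proved; EL♮ NOT proved;
resolution of singularities in positive characteristic NOT proved; nothing of [Hironaka2017] (a candidate under adjudication) is asserted or used.
[OURS · point-set topology over ✓ `IsBlowup.isIso_compl` · standard axioms · DEF-FREE · `--supports stmt-ResolutionOfSingularities-20148 --as helper`,
counted 0 · AI-written, weaker than expert review.] [cite: GortzWedhorn2020, Prop. 13.91 (3)] [cite: StacksProject, Tag 02OS] (method; index only)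
-/

set_option linter.dupNamespace false -- mandated namespace `Summit.<Summit>.<Problem>` of this single-conjunct summit

noncomputable section

open CategoryTheory CategoryTheory.Limits AlgebraicGeometry TopologicalSpace Topology
open Literature.AlgebraicGeometry.Resolution
open AlgebraicGeometry.Scheme.IdealSheafData

namespace Summit.ResolutionOfSingularities.ResolutionOfSingularities.Cruxes.EquisingularLiftNat.Sections

section GenericThread

variable {P X : Scheme.{0}} (σ : X ⟶ P) (Y₀ : Set P) (Y : Set X)

/-- **GEN at the foot of the tower** (`σ = 𝟙`, `Y = Y₀`). [folklore] -/
theorem gen_of_eq : ∀ y, IsGenericPoint y Y₀ → IsGenericPoint ((𝟙 P : P ⟶ P) y) Y₀ :=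
  fun y h => by simpa using h

/-- **The centre does not swallow the running transform**: if the generic points of the irreducible closed `Y` map to generic points of `Y₀` (GEN)
and the image of the centre misses the generic points of `Y₀` (the position token of ✓ `DescTransformOK`), then `¬ Y ⊆ supp C`.
[folklore] [OURS · L1 W4.5b · RUNG LC (B5) bookkeeping] -/
theorem not_subset_support_of_gen (C : X.IdealSheafData) (hYirr : IsIrreducible Y) (hYcl : IsClosed Y)
    (hGEN : ∀ y, IsGenericPoint y Y → IsGenericPoint (σ y) Y₀)
    (hpos : σ '' (C.support : Set X) ⊆ {x | ¬ IsGenericPoint x Y₀}) : ¬ Y ⊆ (C.support : Set X) := by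
  intro hsub
  have hη : IsGenericPoint hYirr.genericPoint Y := hYirr.isGenericPoint_genericPoint hYcl
  exact hpos ⟨hYirr.genericPoint, hsub hη.mem, rfl⟩ (hGEN _ hη)

variable {σ Y₀ Y}

/-- ★ **GEN survives a blow-up step**: for `π : X' → X` a blow-up along `C` (an isomorphism over `X ∖ supp C`, ✓ `IsBlowup.isIso_compl`), `Y`
irreducible closed with `¬ Y ⊆ supp C` and GEN for `(σ, Y₀)`, every generic point `y'` of `Y' = closure (π⁻¹ (Y ∖ supp C))` maps under `π ≫ σ` to a
generic point of `Y₀`.  Indeed `π y'` is generic in `closure (π '' Y')` (Mathlib `IsGenericPoint.image`) and `closure (π '' Y') = Y`: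
`π '' Y' ⊆ Y` (continuity, `Y` closed) and `Y ∖ supp C ⊆ π '' Y'` (over `X ∖ supp C` the blow-up is surjective) with `Y ∖ supp C` dense in `Y`
(Mathlib `subset_closure_inter_of_isPreirreducible_of_isOpen`). [cite: GortzWedhorn2020, Prop. 13.91 (3)] [OURS · L1 W4.5b · RUNG LC (B5) bookkeeping] -/
theorem gen_closure_preimage_diff_of_isBlowup (hYirr : IsIrreducible Y) (hYcl : IsClosed Y) (C : X.IdealSheafData) {X' : Scheme.{0}}
    {π : X' ⟶ X} (hπ : IsBlowup π C) (hGEN : ∀ y, IsGenericPoint y Y → IsGenericPoint (σ y) Y₀) (hne : ¬ Y ⊆ (C.support : Set X)) :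
    ∀ y', IsGenericPoint y' (closure (π ⁻¹' (Y \ (C.support : Set X)))) → IsGenericPoint ((π ≫ σ) y') Y₀ := by
  intro y' hy'
  set S : Set X' := π ⁻¹' (Y \ (C.support : Set X)) with hS
  -- `π y'` is generic in `closure (π '' Y')`
  have h1 : IsGenericPoint (π y') (closure (π '' closure S)) := hy'.image π.continuous
  -- `closure (π '' Y') = Y`
  have hsub : π '' closure S ⊆ Y := by
    refine (image_closure_subset_closure_image π.continuous).trans ?_
    rw [hYcl.closure_subset_iff]
    rintro _ ⟨z, hz, rfl⟩
    exact hz.1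
  -- over `X ∖ supp C` the blow-up is surjective: `Y ∖ supp C ⊆ π '' S ⊆ π '' closure S`
  set W₀ : X.Opens := ⟨(C.support : Set X)ᶜ, C.support.isClosed.isOpen_compl⟩ with hW₀
  haveI : IsIso (π ∣_ W₀) := hπ.isIso_compl
  have hsurj : Y \ (C.support : Set X) ⊆ π '' closure S := by
    intro x hx
    -- a preimage of `x ∈ W₀` under the isomorphism `π ∣_ W₀`
    obtain ⟨a, ha⟩ := (ConcreteCategory.bijective_of_isIso (π ∣_ W₀).base).2 ⟨x, show x ∈ W₀ from hx.2⟩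
    have hπa : π a.1 = x := by
      have := congrArg Subtype.val ha
      rwa [morphismRestrict_base_coe] at this
    refine ⟨a.1, subset_closure ?_, hπa⟩
    show π a.1 ∈ Y \ (C.support : Set X)
    rw [hπa]; exact hx
  have hdense : Y ⊆ closure (Y \ (C.support : Set X)) :=
    subset_closure_inter_of_isPreirreducible_of_isOpen hYirr.isPreirreducible C.support.isClosed.isOpen_compl
      (Set.inter_compl_nonempty_iff.mpr hne)
  have heq : closure (π '' closure S) = Y := by
    refine le_antisymm (by rw [hYcl.closure_subset_iff]; exact hsub) ?_
    exact hdense.trans (closure_mono hsurj)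
  rw [heq] at h1
  rw [Scheme.Hom.comp_apply]
  exact hGEN _ h1

end GenericThread

end Summit.ResolutionOfSingularities.ResolutionOfSingularities.Cruxes.EquisingularLiftNat.Sections

end
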